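import Mathlib.Data.Finset.Card
import Mathlib.Data.Fintype.Powerset
import Mathlib.Data.Set.Function
import HarnessLib

/-!
# `NoHeavyLowerTail` (crux stmt-CriticalPhenomena-4575), hull-port line hp-7: IC/CoI-Kleitman for interval components —
# the SHARP injectivity criterion for the explicit map `ψ ζ = ζ ∪ (x b ∖ y a)`

Support file (prover `prim-hp-7`, generation 52; `--supports stmt-CriticalPhenomena-4575`).  No definitions, no `sorry`,
standard axioms.  Companion of `…JBernSunflowerKleitmanIntervals` (p310343/p310597: general position on the support);
memo `prim-hp-7/FROM-prim-hp-7-g52-KATONA-ANTICHAIN.md` §3.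

Setting as there: pairwise incomparable intervals `[x i, y i]` of the cube, sources `ζ` of type `(a,b)` (`ζ ∈ [x a, y a]`,
`univ ∖ ζ ∈ [x b, y b]`), targets = sets in no interval with complement in no interval, `ψ ζ := ζ ∪ (x b ∖ y a)`.
A direct analysis of `ψ ζ = ψ ξ` for types `(a,b)`, `(c,d)` shows: `a = c` or `b = d` forces `ζ = ξ` outright; otherwise
the bottoms `x b, x c` meet, the bottoms `x a, x d` meet, the co-tops `univ∖y a, univ∖y d` meet and the co-tops
`univ∖y b, univ∖y c` meet (for opposite types these four facts are vacuous, and then the collision forces the pair to be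
TIGHT: `x b = univ ∖ y a`, `x a = univ ∖ y b`, i.e. `[x b, y b] = c[x a, y a]`).  Hence:

THEOREM (`JBern.exists_injOn_target_of_intervals_sharp`, this work): if no opposite pair of types used by `S` sits on a
tight pair and no two types `(a,b) ≠ (c,d)` of `S` (`a ≠ c`, `b ≠ d`, not opposite) have those four intersections all
non-empty ('doubly dead chords'), then `ψ` is an increasing injection of `S` into the targets — for every family `S`, no
intersection / co-intersection hypothesis.  This contains the general-position theorems of the companion file and
isolates exactly what is left of the interval class: tight pairs (the two-petal theorem `…TwoPetalCoInt`, which needs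
co-intersection) and families with doubly dead chords.
[this work]
-/

namespace Summit.CriticalPhenomena.PercolationContinuityZ3.Theorems.JBern

open Finset

variable {α : Type*} [Fintype α] [DecidableEq α] {r : ℕ}

/-- **CoI-Kleitman for interval components, sharp injectivity criterion for `ψ`** (this work).  Pairwise
incomparable intervals; `S` any family of sources with type functions `τ, σ`.  Assume: (`hopp`) no opposite pair of
types of `S` sits on a tight pair of intervals, and (`hdd`) no two types `(a,b) ≠ (c,d)` of `S` with `a ≠ c`, `b ≠ d`,
`(c,d) ≠ (b,a)` have all four of `x b ∩ x c`, `x a ∩ x d`, `(univ∖y a) ∩ (univ∖y d)`, `(univ∖y b) ∩ (univ∖y c)`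
non-empty.  Then `ζ ↦ ζ ∪ (x (σ ζ) ∖ y (τ ζ))` is an increasing injection of `S` into the targets. [this work] -/
theorem exists_injOn_target_of_intervals_sharp (x y : Fin r → Finset α)
    (hinc : ∀ i j, i ≠ j → ¬ x i ⊆ y j) (S : Finset (Finset α)) (τ σ : Finset α → Fin r)
    (hS : ∀ ζ ∈ S, τ ζ ≠ σ ζ ∧ x (τ ζ) ⊆ ζ ∧ ζ ⊆ y (τ ζ) ∧ x (σ ζ) ⊆ univ \ ζ ∧ univ \ ζ ⊆ y (σ ζ))
    (hopp : ∀ ζ ∈ S, ∀ ξ ∈ S, τ ξ = σ ζ → σ ξ = τ ζ →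
      ¬ (x (σ ζ) = univ \ y (τ ζ) ∧ x (τ ζ) = univ \ y (σ ζ)))
    (hdd : ∀ ζ ∈ S, ∀ ξ ∈ S, τ ζ ≠ τ ξ → σ ζ ≠ σ ξ → ¬ (τ ξ = σ ζ ∧ σ ξ = τ ζ) →
      ¬ ((x (σ ζ) ∩ x (τ ξ)).Nonempty ∧ (x (τ ζ) ∩ x (σ ξ)).Nonempty ∧
         ((univ \ y (τ ζ)) ∩ (univ \ y (σ ξ))).Nonempty ∧ ((univ \ y (σ ζ)) ∩ (univ \ y (τ ξ))).Nonempty)) :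
    ∃ φ : Finset α → Finset α, Set.InjOn φ S ∧ ∀ ζ ∈ S, ζ ⊆ φ ζ ∧
      (∀ i, ¬ (x i ⊆ φ ζ ∧ φ ζ ⊆ y i)) ∧ (∀ i, ¬ (x i ⊆ univ \ φ ζ ∧ univ \ φ ζ ⊆ y i)) := by
  classical
  refine ⟨fun ζ => ζ ∪ (x (σ ζ) \ y (τ ζ)), ?_, ?_⟩
  · intro ζ hζ ξ hξ hφ
    have hζ' : ζ ∈ S := hζ
    have hξ' : ξ ∈ S := hξ
    have hφ' : ζ ∪ (x (σ ζ) \ y (τ ζ)) = ξ ∪ (x (σ ξ) \ y (τ ξ)) := hφ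
    obtain ⟨hab, hxa, hya, hxb, hyb⟩ := hS ζ hζ'
    obtain ⟨hcd, hxc, hyc, hxd, hyd⟩ := hS ξ hξ'
    set t := ζ ∪ (x (σ ζ) \ y (τ ζ)) with ht
    -- membership facts about `t`
    have hζt : ζ ⊆ t := subset_union_left
    have hξt : ξ ⊆ t := hφ' ▸ subset_union_left
    have hLζ : x (σ ζ) \ y (τ ζ) ⊆ t := subset_union_right
    have hLξ : x (σ ξ) \ y (τ ξ) ⊆ t := hφ' ▸ subset_union_right
    have ht_cases : ∀ e ∈ t, e ∈ ζ ∨ (e ∈ x (σ ζ) ∧ e ∉ y (τ ζ)) := fun e he => by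
      rcases mem_union.1 he with h | h
      · exact Or.inl h
      · exact Or.inr (mem_sdiff.1 h)
    have ht_cases' : ∀ e ∈ t, e ∈ ξ ∨ (e ∈ x (σ ξ) ∧ e ∉ y (τ ξ)) := fun e he => by
      rcases mem_union.1 (hφ' ▸ he : e ∈ ξ ∪ (x (σ ξ) \ y (τ ξ))) with h | h
      · exact Or.inl h
      · exact Or.inr (mem_sdiff.1 h)
    -- useful: `ζ` avoids `x (σ ζ)` and `univ \ y (τ ζ)`; contains `x (τ ζ)` and `univ \ y (σ ζ)`
    have hζxb : ∀ e ∈ x (σ ζ), e ∉ ζ := fun e he h => (mem_sdiff.1 (hxb he)).2 h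
    have hξxd : ∀ e ∈ x (σ ξ), e ∉ ξ := fun e he h => (mem_sdiff.1 (hxd he)).2 h
    have hζPa : ∀ e ∉ y (τ ζ), e ∉ ζ := fun e he h => he (hya h)
    have hξPc : ∀ e ∉ y (τ ξ), e ∉ ξ := fun e he h => he (hyc h)
    have hPbζ : ∀ e ∉ y (σ ζ), e ∈ ζ := fun e he => by
      by_contra h; exact he (hyb (mem_sdiff.2 ⟨mem_univ e, h⟩))
    have hPdξ : ∀ e ∉ y (σ ξ), e ∈ ξ := fun e he => by
      by_contra h; exact he (hyd (mem_sdiff.2 ⟨mem_univ e, h⟩))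
    -- Case 1: same tail
    by_cases hac : τ ζ = τ ξ
    · -- `ζ = t ∖ (univ ∖ y a) = ξ`
      apply Finset.ext; intro e; constructor
      · intro he
        rcases ht_cases' e (hζt he) with h | ⟨-, h⟩
        · exact h
        · exact (h (hac ▸ hya he)).elim
      · intro he
        rcases ht_cases e (hξt he) with h | ⟨-, h⟩
        · exact h
        · exact (h (hac.symm ▸ hyc he : e ∈ y (τ ζ))).elim
    by_cases hbd : σ ζ = σ ξ
    · -- same head: `ζ = t ∖ x b = ξ`
      apply Finset.ext; intro e; constructor
      · intro he
        rcases ht_cases' e (hζt he) with h | ⟨h, -⟩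
        · exact h
        · exact (hζxb e (hbd ▸ h) he).elim
      · intro he
        rcases ht_cases e (hξt he) with h | ⟨h, -⟩
        · exact h
        · exact (hξxd e (hbd ▸ h) he).elim
    -- Case 3: `a ≠ c`, `b ≠ d`.  Four non-empty intersections, unless opposite.
    exfalso
    -- `x c ⊄ ζ`, so some element of `x c` lies in `x b ∖ y a`
    have h1 : (x (σ ζ) ∩ x (τ ξ)).Nonempty := by
      obtain ⟨e, hec, heζ⟩ := not_subset.1 (fun h => hinc (τ ξ) (τ ζ) (Ne.symm hac) (h.trans hya) : ¬ x (τ ξ) ⊆ ζ)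
      rcases ht_cases e (hξt (hxc hec)) with h | ⟨h, -⟩
      · exact (heζ h).elim
      · exact ⟨e, mem_inter.2 ⟨h, hec⟩⟩
    have h2 : (x (τ ζ) ∩ x (σ ξ)).Nonempty := by
      obtain ⟨e, hea, heξ⟩ := not_subset.1 (fun h => hinc (τ ζ) (τ ξ) hac (h.trans hyc) : ¬ x (τ ζ) ⊆ ξ)
      rcases ht_cases' e (hζt (hxa hea)) with h | ⟨h, -⟩
      · exact (heξ h).elim
      · exact ⟨e, mem_inter.2 ⟨hea, h⟩⟩
    -- `univ \ y d ⊄ ζ` (else `x b ⊆ univ \ ζ ⊆ y d`, so `b = d`), so some element of it lies in `x b ∖ y a`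
    have h3 : ((univ \ y (τ ζ)) ∩ (univ \ y (σ ξ))).Nonempty := by
      have : ¬ (∀ e, e ∉ y (σ ξ) → e ∈ ζ) := fun h =>
        hinc (σ ζ) (σ ξ) hbd fun e he => by
          by_contra hey; exact hζxb e he (h e hey)
      push Not at this
      obtain ⟨e, hed, heζ⟩ := this
      rcases ht_cases e (hξt (hPdξ e hed)) with h | ⟨-, h⟩
      · exact (heζ h).elim
      · exact ⟨e, mem_inter.2 ⟨mem_sdiff.2 ⟨mem_univ e, h⟩, mem_sdiff.2 ⟨mem_univ e, hed⟩⟩⟩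
    have h4 : ((univ \ y (σ ζ)) ∩ (univ \ y (τ ξ))).Nonempty := by
      have : ¬ (∀ e, e ∉ y (σ ζ) → e ∈ ξ) := fun h =>
        hinc (σ ξ) (σ ζ) (Ne.symm hbd) fun e he => by
          by_contra hey; exact hξxd e he (h e hey)
      push Not at this
      obtain ⟨e, heb, heξ⟩ := this
      rcases ht_cases' e (hζt (hPbζ e heb)) with h | ⟨-, h⟩
      · exact (heξ h).elim
      · exact ⟨e, mem_inter.2 ⟨mem_sdiff.2 ⟨mem_univ e, heb⟩, mem_sdiff.2 ⟨mem_univ e, h⟩⟩⟩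
    by_cases hop : τ ξ = σ ζ ∧ σ ξ = τ ζ
    · -- opposite types: the pair must be tight
      obtain ⟨hcb, hda⟩ := hop
      refine hopp ζ hζ' ξ hξ' hcb hda ⟨?_, ?_⟩
      · -- `x b = univ \ y a`: `x b ⊆ t`, `x b ∩ ζ = ∅` gives `x b ⊆ univ \ y a`; `univ \ y a ⊆ t` ... `⊆ x b`
        apply Finset.ext; intro e; constructor
        · intro he
          have hexi : e ∈ ξ := (hcb ▸ hxc : x (σ ζ) ⊆ ξ) he
          rcases ht_cases e (hξt hexi) with h | ⟨-, h⟩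
          · exact (hζxb e he h).elim
          · exact mem_sdiff.2 ⟨mem_univ e, h⟩
        · intro he
          have hea : e ∉ y (τ ζ) := (mem_sdiff.1 he).2
          have : e ∈ ξ := hPdξ e (hda.symm ▸ hea)
          rcases ht_cases e (hξt this) with h | ⟨h, -⟩
          · exact (hζPa e hea h).elim
          · exact h
      · apply Finset.ext; intro e; constructor
        · intro he
          have : e ∈ t := hζt (hxa he)
          rcases ht_cases' e this with h | ⟨-, h⟩
          · exact (hξxd e (hda.symm ▸ he) h).elim
          · exact mem_sdiff.2 ⟨mem_univ e, hcb ▸ h⟩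
        · intro he
          have heb : e ∉ y (σ ζ) := (mem_sdiff.1 he).2
          have heζ : e ∈ ζ := hPbζ e heb
          rcases ht_cases' e (hζt heζ) with h | ⟨h, -⟩
          · exact ((hξPc e (hcb.symm ▸ heb)) h).elim
          · exact hda ▸ h
    · exact hdd ζ hζ' ξ hξ' hac hbd hop ⟨h1, h2, h3, h4⟩
  · intro ζ hζ
    obtain ⟨hab, hxa, hya, hxb, hyb⟩ := hS ζ hζ
    obtain ⟨q, hqb, hqa⟩ := not_subset.1 (hinc (σ ζ) (τ ζ) (Ne.symm hab))
    have hqφ : q ∈ ζ ∪ (x (σ ζ) \ y (τ ζ)) := mem_union_right _ (mem_sdiff.2 ⟨hqb, hqa⟩)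
    refine ⟨subset_union_left, fun i ⟨hxi, hyi⟩ => ?_, fun i ⟨hxi, hyi⟩ => ?_⟩
    · have hi : i = τ ζ := by
        by_contra hia
        exact hinc (τ ζ) i (Ne.symm hia) (hxa.trans (subset_union_left.trans hyi))
      subst hi
      exact hqa (hyi hqφ)
    · have hi : i = σ ζ := by
        by_contra hib
        exact hinc i (σ ζ) hib (hxi.trans ((sdiff_subset_sdiff subset_rfl subset_union_left).trans hyb))
      subst hi
      exact (mem_sdiff.1 (hxi hqb)).2 hqφ

end Summit.CriticalPhenomena.PercolationContinuityZ3.Theorems.JBern
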